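import Summits.SmoothPoincare4.SmoothPoincare4.Theorems.ConvexBisectionAcyclicBisectionExistsStubModelsOnFibredOfReach
import Summits.SmoothPoincare4.SmoothPoincare4.Theorems.ConvexBisectionAcyclicBisectionExistsModelsTransport
import HarnessLib

/-!
# Stub `stub_modelsOnFibred_of_reach` (NF4), line `modp-braid-orbits`, crux
`ConvexBisection.AcyclicBisectionExists` (stmt-SmoothPoincare4-10508): reduction of the two
one-step statements (HS), (ST-front) to X-SLOT statements (no closed manifold, no gluing)

`ConvexBisectionAcyclicBisectionExistsStubModelsOnFibredOfReach.lean` (p114135) reduced the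
registered stub (= `LefschetzBase.modelsOnFibred_of_reach`) to (HS) "a fibred model survives one
signed Hurwitz move" and (ST-front) "a fibred model survives one front stabilisation pair".  Both
still quantify over the closed manifold `M = X ∪_Ψ Base g`.  This file removes `M`:

* §1 `mem_boundary_of_incl_eq_jA` — a seam point `bX.incl y = D.jA a` of the handlebody piece comes
  from a BOUNDARY point `a` of the base (open smooth embeddings preserve boundary points).
* §2 `pageClause_transfer_of_dichotomy` — bookkeeping: if a diffeomorphism `G : X ≅ X'` sends every
  new seam point either to an old seam point ON THE SAME `w`-RAY or to an old deep-belt point whose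
  handle sits in the page of the new point, and the old gluing map `Ψ` carries the `k`-th belt circle
  into the `k`-th page direction (the "belt clause"), then `Ψ ∘ ∂G⁻¹` is page preserving on the new
  seam — the hypothesis `hpage` of `modelsOnFibred_of_transfer` (p128002, T3).
* §3 `hurwitzStep_of_redecomposition` — **(HS) from (M2-T)**: the X-slot statement "the fibred data
  `(X, h, D, bX, Ψ)` of word `l` admit, for `l ↝ l'` one signed Hurwitz move, a Lefschetz link `h'`
  of word `l'` with multi-attachment data `D'` on some `X' ≅_G X` such that `Ψ ∘ ∂G⁻¹` is page
  preserving on the new seam" gives (HS) verbatim (unpack, `modelsOnFibred_of_transfer` with the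
  canonical boundary datum `BoundaryManifold.boundaryData 3 X'`).
  `redecomposition_of_geometric_of_belt` — **(M2-T) from (M2-geo) ∧ (BELT)**: (M2-geo) is the
  `Ψ`-free conclusion (the dichotomy of §2 for `G`), (BELT) the continuity statement that the old
  page clause extends from the seam `jA(∂ Base g ∖ cores)` to the deep belt circles
  (`Ψ(belt_k) ⊂ {arg w = arg (pageDir n k), w ≠ 0}`).
* §4 registered forms `helper_hurwitzStep_of_redecomposition`, `helper_mem_boundary_of_incl_eq_jA`.
The companion file `ConvexBisectionAcyclicBisectionExistsStabRebuildReduction.lean` does the same for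
(ST-front) (rebuild over `Base (g + 1)`) and assembles the registered NF4 signature from the three
X-slot statements (M2-geo), (BELT), (ST-geo).

Design note (worker W6, 2026-08-17; details in the W6 report and the design file `NF4_Design.lean`
published by the lead in the crux workfile directory): the
SAME-SEAM form of the Hurwitz re-decomposition proposed in `Report-r11-NF4.md` §4 (M2)
("`D'.jA a' = D.jA a` with the same `w`-ray for every new boundary seam point `a'`", i.e. new seam
⊆ old seam) is OBSTRUCTED: it forces the old and new deep belts to coincide, and then the
page-preserving diffeomorphism `jA⁻¹ ∘ jA'` between dense open subsets of `∂ Base g` has a page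
class that is locally constant in the page angle and must carry each new attaching circle onto the
isotopy class of the old one in the same page; for `g = 1`, `l = [(a,+),(b,+),(a,+)]`,
`stdSymp a b = 1`, move at positions `(0,1)`, this requires one page class to send `a ↦ ±b` (page of
position `1`) and `a ↦ ±a` (page of position `2`) — impossible.  Hence the transfer form with the
belt alternative (§2–§3), which is what the honest Hurwitz move (Gompf–Stipsicz 1999 §8.2: same
Lefschetz fibration, critical values exchanged by a half twist of the base disc supported away from
its boundary, Kas' presentation re-read) delivers: the new deep belts are the outward vanishing
cycles, which for the two moved handles are NOT the old belts.

References: R. E. Gompf, A. I. Stipsicz, *4-Manifolds and Kirby Calculus* (1999), §8.2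
[GompfStipsicz1999]; A. Kas, Pacific J. Math. 89 (1980) [Kas1980]; R. İ. Baykur, AGT 6 (2006), §5,
Lemma 1 [Baykur2006]; J. B. Etnyre, T. Fuller, IMRN 2006, §2 [EtnyreFuller2006]; M. W. Hirsch,
*Differential Topology* (1976), Ch. 8 §2 [HirschDT1976].
-/

noncomputable section

-- the prescribed namespace `Summit.<P>.<Sub>.…` duplicates `SmoothPoincare4` (P = Sub)
set_option linter.dupNamespace false

open scoped Manifold ContDiff Topology
open Set Function

namespace Summit.SmoothPoincare4.SmoothPoincare4.Theorems.AcyclicBisectionExists.ModpBraidOrbits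

open Literature.GroupTheory.CombinatorialGroupTheory.SignedHurwitz
open Literature.Topology.FourManifolds Literature.Topology.FourManifolds.LefschetzBase
open Literature.Topology.FourManifolds.HandleAttachingMap

namespace ModelsOnFibredOfReach

/-! ## §1 Seam points come from boundary points of the base -/

/-- **A seam point of the handlebody piece comes from a boundary point of the base**: if
`bX.incl y = D.jA a` for a boundary point `y` of `X` and a point `a` of `Base g` off the attaching
circles, then `a ∈ ∂ Base g` (the open smooth embedding `D.jA` of the open submanifold
`Base g ∖ cores` preserves boundary points: `mem_boundary_iff_of_isSmoothEmbedding`,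
`mem_boundary_opens_iff`). [folklore] -/
theorem mem_boundary_of_incl_eq_jA {g n : ℕ} {h : Fin n → HandleAttachingMap 3 2 (Base g)}
    {X : Type*} [TopologicalSpace X] [ChartedSpace (EuclideanHalfSpace 4) X]
    (D : MultiAttachmentData h (𝓡∂ 4) X) (bX : BoundaryData (𝓡∂ 4) X (𝓡 3)) {y : bX.carrier}
    {a : ↥(coresComplement h)} (hy : bX.incl y = D.jA a) :
    (a : Base g) ∈ (𝓡∂ 4).boundary (Base g) := by
  have h1 : D.jA a ∈ (𝓡∂ 4).boundary X := hy ▸ bX.incl_mem_boundary y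
  have h2 : a ∈ (𝓡∂ 4).boundary ↥(coresComplement h) :=
    (mem_boundary_iff_of_isSmoothEmbedding D.hjA D.hjAo a).1 h1
  exact (mem_boundary_opens_iff (coresComplement h) a).1 h2

/-! ## §2 The page clause through a diffeomorphism of the piece: seam/belt dichotomy -/

/-- **Transfer of the page clause along a re-decomposition diffeomorphism.**  Data: the old
handlebody piece `X` over `Base g` (link `h`, data `D`, boundary datum `bX`, gluing map `Ψ`), a new
piece `X'` (link `h'`, data `D'`) and `G : X ≅ X'`.  Hypotheses: (old page clause) `Ψ` is page
preserving on the old seam; (belt clause) `Ψ` sends the `k`-th deep belt circle into the open page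
of direction `pageDir n k`; (dichotomy) `G⁻¹` sends every new boundary seam point `D'.jA a'` either
to an old seam point `D.jA a` with `w a' ∈ ℝ_{>0} · w a`, or to a deep point `D.jB k b ∉ range D.jA`
of the `k`-th handle with `w a' ∈ ℝ_{>0} · pageDir n k`.  Conclusion: `Ψ ∘ ∂G⁻¹` is page
preserving on the new seam, in the form consumed by `modelsOnFibred_of_transfer`. [folklore] -/
theorem pageClause_transfer_of_dichotomy {g n n' : ℕ} {h : Fin n → HandleAttachingMap 3 2 (Base g)}
    {h' : Fin n' → HandleAttachingMap 3 2 (Base g)}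
    {X : Type*} [TopologicalSpace X] [ChartedSpace (EuclideanHalfSpace 4) X]
    {X' : Type*} [TopologicalSpace X'] [ChartedSpace (EuclideanHalfSpace 4) X']
    (D : MultiAttachmentData h (𝓡∂ 4) X) (D' : MultiAttachmentData h' (𝓡∂ 4) X')
    (bX : BoundaryData (𝓡∂ 4) X (𝓡 3)) (Ψ : bX.carrier → (bBase g).carrier)
    (G : X ≃ₘ⟮𝓡∂ 4, 𝓡∂ 4⟯ X')
    (hpage : ∀ (y : bX.carrier) (a : ↥(coresComplement h)), bX.incl y = D.jA a →
      ∃ c : ℝ, 0 < c ∧ w g ((bBase g).incl (Ψ y)).1 = (c : ℂ) * w g (a : Base g).1)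
    (hbelt : ∀ (y : bX.carrier) (k : Fin n) (b : ↥(beltPiece 3 2)), bX.incl y = D.jB k b →
      bX.incl y ∉ range D.jA →
      ∃ c : ℝ, 0 < c ∧ w g ((bBase g).incl (Ψ y)).1 = (c : ℂ) * pageDir n k)
    (hdich : ∀ a' : ↥(coresComplement h'), G.symm (D'.jA a') ∈ (𝓡∂ 4).boundary X →
      (∃ a : ↥(coresComplement h), G.symm (D'.jA a') = D.jA a ∧
        ∃ c : ℝ, 0 < c ∧ w g (a' : Base g).1 = (c : ℂ) * w g (a : Base g).1) ∨
      (∃ (k : Fin n) (b : ↥(beltPiece 3 2)), G.symm (D'.jA a') = D.jB k b ∧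
        G.symm (D'.jA a') ∉ range D.jA ∧
        ∃ c : ℝ, 0 < c ∧ w g (a' : Base g).1 = (c : ℂ) * pageDir n k)) :
    ∀ (y : bX.carrier) (a' : ↥(coresComplement h')), G (bX.incl y) = D'.jA a' →
      ∃ c : ℝ, 0 < c ∧ w g ((bBase g).incl (Ψ y)).1 = (c : ℂ) * w g (a' : Base g).1 := by
  intro y a' hy
  have hz : G.symm (D'.jA a') = bX.incl y := by
    rw [← hy, Diffeomorph.symm_apply_apply]
  have hzb : G.symm (D'.jA a') ∈ (𝓡∂ 4).boundary X := hz ▸ bX.incl_mem_boundary y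
  rcases hdich a' hzb with ⟨a, ha, c₁, hc₁, hw₁⟩ | ⟨k, b, hb, hnot, c₁, hc₁, hw₁⟩
  · obtain ⟨c₂, hc₂, hw₂⟩ := hpage y a (hz ▸ ha)
    refine ⟨c₂ / c₁, div_pos hc₂ hc₁, ?_⟩
    have hc₁' : (c₁ : ℂ) ≠ 0 := by exact_mod_cast hc₁.ne'
    rw [hw₂, hw₁, ← mul_assoc]
    congr 1
    push_cast
    rw [div_mul_cancel₀ _ hc₁']
  · obtain ⟨c₂, hc₂, hw₂⟩ := hbelt y k b (hz ▸ hb) (hz ▸ hnot)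
    refine ⟨c₂ / c₁, div_pos hc₂ hc₁, ?_⟩
    have hc₁' : (c₁ : ℂ) ≠ 0 := by exact_mod_cast hc₁.ne'
    rw [hw₂, hw₁, ← mul_assoc]
    congr 1
    push_cast
    rw [div_mul_cancel₀ _ hc₁']

/-! ## §3 (HS) from the X-slot statements -/

/-- **(HS) from the transfer form (M2-T) of the Hurwitz re-decomposition.**  If for every fibred
datum `(X, h, D, bX, Ψ)` of word `l` over `Base g` (Lefschetz link, multi-attachment data, boundary
datum, PAGE-PRESERVING gluing map — no closed manifold) and every signed Hurwitz move `l ↝ l'`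
there are a Lefschetz link `h'` of word `l'`, data `D'` on a compact piece `X'` and `G : X ≅ X'` with
`Ψ ∘ ∂G⁻¹` page preserving on the new seam, then fibred models of closed manifolds survive one
signed Hurwitz move: `modelsOnFibred_of_transfer` (Hirsch 1976, §8.2: the gluing only sees the
piece up to diffeomorphism) with the canonical boundary datum of `X'`.  Gompf–Stipsicz 1999, §8.2
(Hurwitz moves do not change the fibration). [cite: GompfStipsicz1999, §8.2] -/
theorem hurwitzStep_of_redecomposition
    (hM2 : ∀ (g : ℕ) (l l' : IntWord g), HurwitzStep (stdSymp ℤ g) l l' →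
      ∀ (X : Type) [TopologicalSpace X] [T2Space X] [SecondCountableTopology X] [CompactSpace X]
        [ChartedSpace (EuclideanHalfSpace 4) X] [IsManifold (𝓡∂ 4) ∞ X]
        (h : Fin l.length → HandleAttachingMap 3 2 (Base g))
        (D : MultiAttachmentData h (𝓡∂ 4) X) (bX : BoundaryData (𝓡∂ 4) X (𝓡 3))
        (Ψ : bX.carrier ≃ₘ⟮𝓡 3, 𝓡 3⟯ (bBase g).carrier),
        IsLefschetzLink g l h →
        (∀ (y : bX.carrier) (a : ↥(coresComplement h)), bX.incl y = D.jA a →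
          ∃ c : ℝ, 0 < c ∧ w g ((bBase g).incl (Ψ y)).1 = (c : ℂ) * w g (a : Base g).1) →
        ∃ (X' : Type) (_ : TopologicalSpace X') (_ : T2Space X') (_ : SecondCountableTopology X')
          (_ : CompactSpace X') (_ : ChartedSpace (EuclideanHalfSpace 4) X')
          (_ : IsManifold (𝓡∂ 4) ∞ X') (h' : Fin l'.length → HandleAttachingMap 3 2 (Base g))
          (D' : MultiAttachmentData h' (𝓡∂ 4) X') (G : X ≃ₘ⟮𝓡∂ 4, 𝓡∂ 4⟯ X'),
          IsLefschetzLink g l' h' ∧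
          ∀ (y : bX.carrier) (a' : ↥(coresComplement h')), G (bX.incl y) = D'.jA a' →
            ∃ c : ℝ, 0 < c ∧ w g ((bBase g).incl (Ψ y)).1 = (c : ℂ) * w g (a' : Base g).1) :
    ∀ (M : Type) [TopologicalSpace M] [T2Space M] [SecondCountableTopology M]
      [ChartedSpace (EuclideanSpace ℝ (Fin 4)) M] [IsManifold (𝓡 4) ∞ M] (g : ℕ) (l l' : IntWord g),
      ModelsOnFibred M g l → HurwitzStep (stdSymp ℤ g) l l' → ModelsOnFibred M g l' := by
  intro M _ _ _ _ _ g l l' hM hst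
  obtain ⟨X, _, _, _, _, _, _, h, D, bX, Ψ, hlink, hglue, hpage⟩ := hM
  obtain ⟨X', _, _, _, _, _, _, h', D', G, hlink', hpage'⟩ :=
    hM2 g l l' hst X h D bX Ψ hlink hpage
  exact modelsOnFibred_of_transfer hlink' D' bX (BoundaryManifold.boundaryData 3 X') Ψ hglue G hpage'

/-- **(M2-T) from the `Ψ`-free re-decomposition (M2-geo) and the belt clause (BELT).**
(M2-geo): for fibred data `(X, h, D, bX, Ψ)` of word `l` and a signed Hurwitz move `l ↝ l'` there
are `h'` (Lefschetz link of `l'`), `D'` on a compact `X'` and `G : X ≅ X'` such that every new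
boundary seam point goes under `G⁻¹` to an old seam point on the same `w`-ray or to an old deep
belt point of the handle sitting in its page (Gompf–Stipsicz 1999 §8.2 / Kas 1980: the SAME
Lefschetz fibration with the two critical values exchanged by a half twist of the base disc
supported off its boundary, re-read through Kas' presentation; the new deep belts are the outward
vanishing cycles).  (BELT): the page clause of a fibred datum extends by continuity from the seam
to the deep belt circles, `Ψ(belt_k) ⊂ {w ∈ ℝ_{>0} · pageDir n k}` (the belt circle of handle `k`
is the limit of seam points `D.jA a`, `a → attaching circle ⊂ page (pageDir n k)`, and `Ψ(belt_k)`
misses the binding because `Ψ ∘ D.jA` maps the binding circle of `∂ Base g` onto itself).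
Bookkeeping: `pageClause_transfer_of_dichotomy`. [cite: GompfStipsicz1999, §8.2] -/
theorem redecomposition_of_geometric_of_belt
    (hgeo : ∀ (g : ℕ) (l l' : IntWord g), HurwitzStep (stdSymp ℤ g) l l' →
      ∀ (X : Type) [TopologicalSpace X] [T2Space X] [SecondCountableTopology X] [CompactSpace X]
        [ChartedSpace (EuclideanHalfSpace 4) X] [IsManifold (𝓡∂ 4) ∞ X]
        (h : Fin l.length → HandleAttachingMap 3 2 (Base g))
        (D : MultiAttachmentData h (𝓡∂ 4) X) (bX : BoundaryData (𝓡∂ 4) X (𝓡 3))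
        (Ψ : bX.carrier ≃ₘ⟮𝓡 3, 𝓡 3⟯ (bBase g).carrier),
        IsLefschetzLink g l h →
        (∀ (y : bX.carrier) (a : ↥(coresComplement h)), bX.incl y = D.jA a →
          ∃ c : ℝ, 0 < c ∧ w g ((bBase g).incl (Ψ y)).1 = (c : ℂ) * w g (a : Base g).1) →
        ∃ (X' : Type) (_ : TopologicalSpace X') (_ : T2Space X') (_ : SecondCountableTopology X')
          (_ : CompactSpace X') (_ : ChartedSpace (EuclideanHalfSpace 4) X')
          (_ : IsManifold (𝓡∂ 4) ∞ X') (h' : Fin l'.length → HandleAttachingMap 3 2 (Base g))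
          (D' : MultiAttachmentData h' (𝓡∂ 4) X') (G : X ≃ₘ⟮𝓡∂ 4, 𝓡∂ 4⟯ X'),
          IsLefschetzLink g l' h' ∧
          ∀ a' : ↥(coresComplement h'), G.symm (D'.jA a') ∈ (𝓡∂ 4).boundary X →
            (∃ a : ↥(coresComplement h), G.symm (D'.jA a') = D.jA a ∧
              ∃ c : ℝ, 0 < c ∧ w g (a' : Base g).1 = (c : ℂ) * w g (a : Base g).1) ∨
            (∃ (k : Fin l.length) (b : ↥(beltPiece 3 2)), G.symm (D'.jA a') = D.jB k b ∧
              G.symm (D'.jA a') ∉ range D.jA ∧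
              ∃ c : ℝ, 0 < c ∧ w g (a' : Base g).1 = (c : ℂ) * pageDir l.length k))
    (hbelt : ∀ (g : ℕ) (l : IntWord g) (X : Type) [TopologicalSpace X] [T2Space X]
      [SecondCountableTopology X] [CompactSpace X] [ChartedSpace (EuclideanHalfSpace 4) X]
      [IsManifold (𝓡∂ 4) ∞ X] (h : Fin l.length → HandleAttachingMap 3 2 (Base g))
      (D : MultiAttachmentData h (𝓡∂ 4) X) (bX : BoundaryData (𝓡∂ 4) X (𝓡 3))
      (Ψ : bX.carrier ≃ₘ⟮𝓡 3, 𝓡 3⟯ (bBase g).carrier),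
      IsLefschetzLink g l h →
      (∀ (y : bX.carrier) (a : ↥(coresComplement h)), bX.incl y = D.jA a →
        ∃ c : ℝ, 0 < c ∧ w g ((bBase g).incl (Ψ y)).1 = (c : ℂ) * w g (a : Base g).1) →
      ∀ (y : bX.carrier) (k : Fin l.length) (b : ↥(beltPiece 3 2)), bX.incl y = D.jB k b →
        bX.incl y ∉ range D.jA →
        ∃ c : ℝ, 0 < c ∧ w g ((bBase g).incl (Ψ y)).1 = (c : ℂ) * pageDir l.length k) :
    ∀ (g : ℕ) (l l' : IntWord g), HurwitzStep (stdSymp ℤ g) l l' →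
      ∀ (X : Type) [TopologicalSpace X] [T2Space X] [SecondCountableTopology X] [CompactSpace X]
        [ChartedSpace (EuclideanHalfSpace 4) X] [IsManifold (𝓡∂ 4) ∞ X]
        (h : Fin l.length → HandleAttachingMap 3 2 (Base g))
        (D : MultiAttachmentData h (𝓡∂ 4) X) (bX : BoundaryData (𝓡∂ 4) X (𝓡 3))
        (Ψ : bX.carrier ≃ₘ⟮𝓡 3, 𝓡 3⟯ (bBase g).carrier),
        IsLefschetzLink g l h →
        (∀ (y : bX.carrier) (a : ↥(coresComplement h)), bX.incl y = D.jA a →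
          ∃ c : ℝ, 0 < c ∧ w g ((bBase g).incl (Ψ y)).1 = (c : ℂ) * w g (a : Base g).1) →
        ∃ (X' : Type) (_ : TopologicalSpace X') (_ : T2Space X') (_ : SecondCountableTopology X')
          (_ : CompactSpace X') (_ : ChartedSpace (EuclideanHalfSpace 4) X')
          (_ : IsManifold (𝓡∂ 4) ∞ X') (h' : Fin l'.length → HandleAttachingMap 3 2 (Base g))
          (D' : MultiAttachmentData h' (𝓡∂ 4) X') (G : X ≃ₘ⟮𝓡∂ 4, 𝓡∂ 4⟯ X'),
          IsLefschetzLink g l' h' ∧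
          ∀ (y : bX.carrier) (a' : ↥(coresComplement h')), G (bX.incl y) = D'.jA a' →
            ∃ c : ℝ, 0 < c ∧ w g ((bBase g).incl (Ψ y)).1 = (c : ℂ) * w g (a' : Base g).1 := by
  intro g l l' hst X _ _ _ _ _ _ h D bX Ψ hlink hpage
  obtain ⟨X', _, _, _, _, _, _, h', D', G, hlink', hdich⟩ :=
    hgeo g l l' hst X h D bX Ψ hlink hpage
  exact ⟨X', inferInstance, inferInstance, inferInstance, inferInstance, inferInstance,
    inferInstance, h', D', G, hlink',
    pageClause_transfer_of_dichotomy D D' bX Ψ G hpage (hbelt g l X h D bX Ψ hlink hpage) hdich⟩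

end ModelsOnFibredOfReach

open ModelsOnFibredOfReach

/-! ## §4 Registered forms -/

/-- **(HS), registered form: fibred models survive one signed Hurwitz move, GIVEN the transfer
form (M2-T) of the one-move re-decomposition of the handlebody piece** (`hurwitzStep_of_redecomposition`;
Gompf–Stipsicz 1999 §8.2, Hirsch 1976 §8.2). [cite: GompfStipsicz1999, §8.2] -/
theorem helper_hurwitzStep_of_redecomposition :
    (∀ (g : ℕ) (l l' : Literature.GroupTheory.CombinatorialGroupTheory.SignedHurwitz.IntWord g),
      Literature.GroupTheory.CombinatorialGroupTheory.SignedHurwitz.HurwitzStep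
      (Literature.GroupTheory.CombinatorialGroupTheory.SignedHurwitz.stdSymp ℤ g) l l' → ∀ (X :
      Type) [TopologicalSpace X] [T2Space X] [SecondCountableTopology X] [CompactSpace X]
      [ChartedSpace (EuclideanHalfSpace 4) X] [IsManifold (𝓡∂ 4) ∞ X] (h : Fin l.length →
      Literature.Topology.FourManifolds.HandleAttachingMap 3 2
      (Literature.Topology.FourManifolds.LefschetzBase.Base g)) (D :
      Literature.Topology.FourManifolds.HandleAttachingMap.MultiAttachmentData h (𝓡∂ 4) X) (bX :
      Literature.Topology.FourManifolds.BoundaryData (𝓡∂ 4) X (𝓡 3)) (Ψ : bX.carrier ≃ₘ⟮𝓡 3, 𝓡 3⟯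
      (Literature.Topology.FourManifolds.LefschetzBase.bBase g).carrier),
      Literature.Topology.FourManifolds.LefschetzBase.IsLefschetzLink g l h → (∀ (y : bX.carrier)
      (a : ↥(Literature.Topology.FourManifolds.HandleAttachingMap.coresComplement h)), bX.incl y =
      D.jA a → ∃ c : ℝ, 0 < c ∧ Literature.Topology.FourManifolds.LefschetzBase.w g
      ((Literature.Topology.FourManifolds.LefschetzBase.bBase g).incl (Ψ y)).1 = (c : ℂ) *
      Literature.Topology.FourManifolds.LefschetzBase.w g (a :
      Literature.Topology.FourManifolds.LefschetzBase.Base g).1) → ∃ (X' : Type) (_ :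
      TopologicalSpace X') (_ : T2Space X') (_ : SecondCountableTopology X') (_ : CompactSpace X')
      (_ : ChartedSpace (EuclideanHalfSpace 4) X') (_ : IsManifold (𝓡∂ 4) ∞ X') (h' : Fin
      l'.length → Literature.Topology.FourManifolds.HandleAttachingMap 3 2
      (Literature.Topology.FourManifolds.LefschetzBase.Base g)) (D' :
      Literature.Topology.FourManifolds.HandleAttachingMap.MultiAttachmentData h' (𝓡∂ 4) X') (G :
      X ≃ₘ⟮𝓡∂ 4, 𝓡∂ 4⟯ X'), Literature.Topology.FourManifolds.LefschetzBase.IsLefschetzLink g l'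
      h' ∧ ∀ (y : bX.carrier) (a' :
      ↥(Literature.Topology.FourManifolds.HandleAttachingMap.coresComplement h')), G (bX.incl y) =
      D'.jA a' → ∃ c : ℝ, 0 < c ∧ Literature.Topology.FourManifolds.LefschetzBase.w g
      ((Literature.Topology.FourManifolds.LefschetzBase.bBase g).incl (Ψ y)).1 = (c : ℂ) *
      Literature.Topology.FourManifolds.LefschetzBase.w g (a' :
      Literature.Topology.FourManifolds.LefschetzBase.Base g).1) → ∀ (M : Type) [TopologicalSpace
      M] [T2Space M] [SecondCountableTopology M] [ChartedSpace (EuclideanSpace ℝ (Fin 4)) M]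
      [IsManifold (𝓡 4) ∞ M] (g : ℕ) (l l' :
      Literature.GroupTheory.CombinatorialGroupTheory.SignedHurwitz.IntWord g),
      Literature.Topology.FourManifolds.LefschetzBase.ModelsOnFibred M g l →
      Literature.GroupTheory.CombinatorialGroupTheory.SignedHurwitz.HurwitzStep
      (Literature.GroupTheory.CombinatorialGroupTheory.SignedHurwitz.stdSymp ℤ g) l l' →
      Literature.Topology.FourManifolds.LefschetzBase.ModelsOnFibred M g l' :=
  fun hM2 => hurwitzStep_of_redecomposition hM2

/-- **Registered form of §1: a seam point of the handlebody piece comes from a boundary point of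
the base** (open smooth embeddings preserve boundary points). [folklore] -/
theorem helper_mem_boundary_of_incl_eq_jA :
    ∀ (g n : ℕ) (h : Fin n → Literature.Topology.FourManifolds.HandleAttachingMap 3 2
      (Literature.Topology.FourManifolds.LefschetzBase.Base g)) (X : Type) [TopologicalSpace X]
      [ChartedSpace (EuclideanHalfSpace 4) X] (D :
      Literature.Topology.FourManifolds.HandleAttachingMap.MultiAttachmentData h (𝓡∂ 4) X) (bX :
      Literature.Topology.FourManifolds.BoundaryData (𝓡∂ 4) X (𝓡 3)) (y : bX.carrier) (a :
      ↥(Literature.Topology.FourManifolds.HandleAttachingMap.coresComplement h)), bX.incl y = D.jA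
      a → (a : Literature.Topology.FourManifolds.LefschetzBase.Base g) ∈ (𝓡∂ 4).boundary
      (Literature.Topology.FourManifolds.LefschetzBase.Base g) :=
  fun _ _ _ _ _ _ D bX _ _ hy => mem_boundary_of_incl_eq_jA D bX hy

end Summit.SmoothPoincare4.SmoothPoincare4.Theorems.AcyclicBisectionExists.ModpBraidOrbits

end
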